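import Summits.BirchSwinnertonDyer.BirchSwinnertonDyer.Theorems.SemiOrdinaryEisensteinDescentWildKolyvaginUpperAtThreeTight
import Summits.BirchSwinnertonDyer.BirchSwinnertonDyer.Theorems.SemiOrdinaryEisensteinDescentWildKolyvaginUpperAtThreeOfJointUpper
import Summits.BirchSwinnertonDyer.BirchSwinnertonDyer.Theorems.SemiOrdinaryEisensteinDescentWildSigmaDivisibilityAtThreeOfKo
import HarnessLib

/-!
# Crux of record J‴ `WildSigmaDivisibilityAtThreeMultiCarrier` (stmt-BirchSwinnertonDyer-25898) and its parent J′ (24702) are TIGHT BY NAME: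
# each follows from the leaf `WAllExclAddWildRankOneSurj` it serves plus the route's residual `WAllExclAddWildRankZero` (Z), modulo
# named print ONLY (Gross–Zagier, Kolyvagin, GZK, modularity, GZ86 I.(7.3), Matar–Nekovář Thm. 0.7 lower half) — NO tower, NO structure shape
# (route `SemiOrdinaryEisensteinDescent`; width seat `bsd-wall-soed-p2-w2` g7; `--supports stmt-BirchSwinnertonDyer-25898`, helper)

WHY. The vets' strength certificates for J‴ read «J‴ → J′ with index slack 1» (tk5j) and «no cheap kill: a counterexample = a BSD₃(E/K)
counterexample» (prose). This file makes the second one a KERNEL theorem in J‴'s own POINT currency and with tower-free print inputs: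
BSD₃(E) ∧ BSD₃(E^{d_K}) ⟹ co-STEP L at slack `v₃ c` at every frame (soed-p2-w3 g0's p580751 `indexUpperBoundLeAt_of_bsdp_of_bsdp`, via
the EXACT Gross–Zagier index identity) ⟹ σ-divisibility of the Kolyvagin points to the full depth `ord₃ ∏ c_q + v₃ c` at the frame
(lead g0's `WildSigmaDivisibilityAtThreeOfKo.globalDivisibility_of_upper_of_surj`: a non-divisible `P(n)` at depth `s′` would force
`3^{2(M₀−s′+1)} ∣ #Ш(E/K)` by the LOWER half of the structure theorem under irreducibility, Matar–Nekovář 2019 Thm. 0.7/§0.11, contradicting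
the socket; `ρ̄₃` onto only — NO `3`-adic tower). Hence J′ and J‴ BY NAME from the two leaves; compare p623098 (same seat), which reaches the
TOWER aside J (20760) through the typed structure SHAPE instead.

WHAT IS PROVED (theorems only; no definition, no named fact, no `sorry`; CONDITIONAL on the displayed named facts and on the two conjectural
leaves taken as hypotheses — nothing is asserted about any curve):
* §1 `sigma_at_of_bsdp_of_bsdp_towerFree` — at ANY frame of the onto wild `r = 1` cell (level `N = N_E`, admissible `K`, `Dt`, `H`, `ι`,
  non-torsion `P ↦ y_K`; NO tower) and a globally minimal model `Wd` of `E^{d_K}`: `BSDp W 3 ∧ BSDp Wd 3` + the six named facts ⟹ J′'s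
  conclusion at the frame.
* §2 `sigma_at_of_leaf_of_rankZero` — the same from the leaf `WAllExclAddWildRankOneSurj` and the residual `WAllExclAddWildRankZero`
  (`BSD₃(E)`: non-CM from `ρ̄₃` onto; `BSD₃(Wd)`: `Wd` is a non-CM O6 curve of analytic rank `0`, `classO6_twist_of_heegner`).
* §3 **`wildSigmaDivisibilityAtThreeTowerFree_of_wAllExclAddWildRankOneSurj_of_wAllExclAddWildRankZero`** (J′ 24702 BY NAME) and
  **`wildSigmaDivisibilityAtThreeMultiCarrier_of_wAllExclAddWildRankOneSurj_of_wAllExclAddWildRankZero`** (J‴ 25898 BY NAME); and line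
  `birth`'s research stub `stub_flatMultiCarrier` VERBATIM from the same (`flatMultiCarrier_of_…`).
NET (rung currency): modulo {GZ, Kolyvagin, GZK, modularity, GZ86 I.(7.3), MN19 Thm. 0.7-lower} the crux of record J‴ — and the line's
research stub — are COROLLARIES of `WAllExclAddWildRankOneSurj ∧ WAllExclAddWildRankZero`: J‴ carries NO surplus over BSD₃ on the cell (with the
route's own Z), on tower AND non-tower rows. Together with the route's `closes` (J‴ + E_𝟙^V + Z + print ⟹ leaf) the Kolyvagin column is an
honest EQUIVALENCE modulo print and the other cruxes. HONEST FRAMING: nothing here proves J‴ or BSD; the six facts are hypotheses by name.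

References: [GrossZagier1986] I (6.3), (7.3), V (2.2); [MatarNekovar2019] Thm. 0.7, §0.11; [McCallumLMS1991] §5 Lemma 5.1, Cor. 5.6;
[JetchevSkinnerWan2017] §7.4.1; [Jetchev2008] Conj. 1.3, Cor. 1.5; [Miller2011LMS] Def. 1.1.
-/

set_option autoImplicit false
set_option linter.dupNamespace false -- `Summit.BirchSwinnertonDyer.BirchSwinnertonDyer.…` is the tree's layout (D-0017)

noncomputable section

open scoped Classical

namespace Summit.BirchSwinnertonDyer.BirchSwinnertonDyer.Theorems.WildSigmaDivisibilityAtThreeMultiCarrierTight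

open WeierstrassCurve NumberField IsDedekindDomain Field Literature.NumberTheory.EllipticCurves
  Literature.NumberTheory.EllipticCurves.ModularForms
  Literature.NumberTheory.EllipticCurves.Rank1Residual
  Literature.NumberTheory.EllipticCurves.Rank1Residual.Typed
  Summit.BirchSwinnertonDyer.Rank1Residual
  Summit.BirchSwinnertonDyer.Rank1Residual.Additive
  Summit.BirchSwinnertonDyer.Rank1Residual.X11b
  Summit.BirchSwinnertonDyer.Rank1Residual.X11b.Three
  Summit.BirchSwinnertonDyer.BirchSwinnertonDyer.Theses.SemiOrdinaryEisensteinDescent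
  Summit.BirchSwinnertonDyer.BirchSwinnertonDyer.Theorems.SchneiderFree
  Summit.BirchSwinnertonDyer.BirchSwinnertonDyer.Theorems.WildKolyvaginUpperAtThreeTight
  Summit.BirchSwinnertonDyer.BirchSwinnertonDyer.Theorems.WildKolyvaginUpperAtThreeOfJointUpper
  Summit.BirchSwinnertonDyer.BirchSwinnertonDyer.Theorems.WildSigmaDivisibilityAtThreeOfKo

/-! ## §1 `BSD₃(E) ∧ BSD₃(E^{d_K})` ⟹ σ-divisibility to the full depth at ANY frame (no tower) -/

/-- **σ-divisibility at a frame from the two BSD₃'s, tower-free.** Frame of the cell at the conductor level: onto wild `r = 1` curve `W`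
(`ρ̄₃` onto ONLY), admissible `K` (imaginary quadratic, Heegner, `d_K` odd `≠ −3`, `L(E^{d_K},1) ≠ 0`), `Dt`, `H`, `ι`, non-torsion `P ↦ y_K`;
`Wd` a globally minimal model of the twist. Then `BSDp W 3 ∧ BSDp Wd 3` + {Gross–Zagier I.(6.3), Kolyvagin, GZK, modularity, GZ86 I.(7.3)} give
the socket `Upper.IndexUpperBoundLeAt W 3 K P (v₃ c)` (`indexUpperBoundLeAt_of_bsdp_of_bsdp`), and {Kolyvagin, MN19 Thm. 0.7-lower} turn it
into `3^{s′} ∣ P(n)` for all `s′ ≤ ord₃ ∏ c_q + v₃ c` and all Zhang–Kolyvagin `n` of index `≥ s′` (`globalDivisibility_of_upper_of_surj`).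
[cite: GrossZagier1986, Thm. I.(6.3), (7.3) and V (2.2)] [cite: MatarNekovar2019, Thm. 0.7 (p. 456) and §0.11 (p. 457)]
[cite: McCallumLMS1991, §5 Lemma 5.1 and Cor. 5.6 (p. 310)] -/
theorem sigma_at_of_bsdp_of_bsdp_towerFree
    (hGZ : ∀ (N : ℕ) [NeZero N] (W : WeierstrassCurve ℚ) (K : Type) [Field K] [NumberField K],
      gross_zagier N W K)
    (hKo : ∀ (N : ℕ) [NeZero N] (W : WeierstrassCurve ℚ) (K : Type) [Field K] [NumberField K],
      kolyvagin N W K)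
    (hGZK : rank_eq_analyticRank_of_analyticRank_le_one) (hmod : hasEntireLFunction_rat)
    (hGZ73 : GrossZagier1986_thm_I_7_3)
    (hMNlow : MatarNekovar2019.thm07_pow_dvd_card_sha_primary_of_certificate_of_irreducible)
    (W : WeierstrassCurve ℚ) [W.IsElliptic] [W.IsGloballyMinimal] [NeZero (W.conductorNorm ℤ)]
    (K : Type) [Field K] [NumberField K] (Dt : ModularParametrizationData W (W.conductorNorm ℤ))
    (H : HeegnerDatum (W.conductorNorm ℤ) (NumberField.discr K)) (ι : K →+* ℂ) (P : (W.baseChange K).toAffine.Point)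
    (Wd : WeierstrassCurve ℚ) [Wd.IsElliptic] [Wd.IsGloballyMinimal]
    (hO6 : ClassO6 W 3) (hsurj : W.HasSurjectiveModNGaloisRep 3) (hr : W.analyticRank = 1)
    (hK : IsImaginaryQuadratic K) (hHH : SatisfiesHeegnerHypothesis (W.conductorNorm ℤ) K)
    (hLd : (W.quadraticTwist (NumberField.discr K : ℚ)).entireLFunction 1 ≠ 0)
    (hP : WeierstrassCurve.Affine.Point.map ι.toRatAlgHom P = heegnerPointComplex Dt H)
    (hnt : ¬ IsOfFinAddOrder P) (hodd : Odd (NumberField.discr K)) (h3 : NumberField.discr K ≠ -3)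
    (hC : ∃ C : VariableChange ℚ, C • W.quadraticTwist (NumberField.discr K : ℚ) = Wd)
    (hbsd : BSDp W 3) (hbsdd : BSDp Wd 3) :
    ∀ (s' : ℕ), s' ≤ padicValNat 3 W.tamagawaProduct + padicValNat 3 Dt.c.natAbs →
      ∀ (n : ℕ) (d : KolyvaginHeegnerData Dt H.β ι n), Squarefree n →
        (∀ ℓ ∈ n.primeFactors, Zhang2014.IsKolyvaginPrime (W.conductorNorm ℤ) W K 3 ℓ ∧
          s' ≤ Zhang2014.kolyvaginIndex W 3 ℓ) → Koly.PDiv d 3 s' := by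
  haveI : Fact (Nat.Prime 3) := ⟨Nat.prime_three⟩
  have h4 : NumberField.discr K ≠ -4 := by
    rintro h; rw [h] at hodd; exact (by decide : ¬ Odd (-4 : ℤ)) hodd
  have h3N : 3 ∣ W.conductorNorm ℤ :=
    (W.dvd_conductorNorm_iff_not_hasGoodReductionAtPrime 3).mpr (not_good_of_addv W 3 hO6.2.1)
  have hw : ¬ 3 ∣ Units.torsionOrder K :=
    (X11b.Three.not_dvd_discr_and_not_dvd_torsionOrder_of_heegner hK hHH (by decide) h3N).2
  have hup : Upper.IndexUpperBoundLeAt W 3 K P (padicValNat 3 Dt.c.natAbs) :=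
    indexUpperBoundLeAt_of_bsdp_of_bsdp hGZ hKo hGZK hmod hGZ73 W 3 (W.conductorNorm ℤ) K Dt H ι P Wd hr rfl h3N hK hodd hw
      hHH hLd hP hC (by decide) hbsd hbsdd
  exact globalDivisibility_of_upper_of_surj hKo hMNlow W hsurj K hK h3 h4 hHH Dt H ι P hP hnt hup

/-! ## §2 From the leaf and the rank-zero residual, at every frame (any level, no tower) -/

/-- **σ-divisibility at every frame of the cell from `WAllExclAddWildRankOneSurj` and `WAllExclAddWildRankZero`** (any level `N = N_E`; no tower):
`BSD₃(E)` from the leaf (`E` non-CM from `ρ̄₃` onto), `BSD₃(Wd)` from the residual for a globally minimal model `Wd` of `E^{d_K}`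
(`hasGlobalMinimalModel_rat_holds`; a non-CM O6 curve of analytic rank `0` by `classO6_twist_of_heegner`), then §1. CONDITIONAL on the two
leaves and the six named facts. [cite: GrossZagier1986, Thm. I.(6.3), (7.3) and V (2.2)] [cite: MatarNekovar2019, Thm. 0.7 and §0.11]
[cite: Jetchev2008, Conj. 1.3 and Cor. 1.5 (p. 812)] -/
theorem sigma_at_of_leaf_of_rankZero
    (hGZ : ∀ (N : ℕ) [NeZero N] (W : WeierstrassCurve ℚ) (K : Type) [Field K] [NumberField K],
      gross_zagier N W K)
    (hKo : ∀ (N : ℕ) [NeZero N] (W : WeierstrassCurve ℚ) (K : Type) [Field K] [NumberField K],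
      kolyvagin N W K)
    (hGZK : rank_eq_analyticRank_of_analyticRank_le_one) (hmod : hasEntireLFunction_rat)
    (hGZ73 : GrossZagier1986_thm_I_7_3)
    (hMNlow : MatarNekovar2019.thm07_pow_dvd_card_sha_primary_of_certificate_of_irreducible)
    (hLeaf : Summit.BirchSwinnertonDyer.WAllExclAddWildRankOneSurj)
    (hZ : Summit.BirchSwinnertonDyer.WAllExclAddWildRankZero)
    (W : WeierstrassCurve ℚ) [W.IsElliptic] [W.IsGloballyMinimal] (N : ℕ) [NeZero N] (K : Type)
    [Field K] [NumberField K] (Dt : ModularParametrizationData W N)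
    (H : HeegnerDatum N (NumberField.discr K)) (ι : K →+* ℂ) (P : (W.baseChange K).toAffine.Point)
    (hO6 : ClassO6 W 3) (hsurj : W.HasSurjectiveModNGaloisRep 3) (hr : W.analyticRank = 1) (hN : W.conductorNorm ℤ = N)
    (hK : IsImaginaryQuadratic K) (hHH : SatisfiesHeegnerHypothesis N K)
    (hLd : (W.quadraticTwist (NumberField.discr K : ℚ)).entireLFunction 1 ≠ 0)
    (hP : WeierstrassCurve.Affine.Point.map ι.toRatAlgHom P = heegnerPointComplex Dt H)
    (hnt : ¬ IsOfFinAddOrder P) (hodd : Odd (NumberField.discr K)) (h3 : NumberField.discr K ≠ -3) :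
    ∀ (s' : ℕ), s' ≤ padicValNat 3 W.tamagawaProduct + padicValNat 3 Dt.c.natAbs →
      ∀ (n : ℕ) (d : KolyvaginHeegnerData Dt H.β ι n), Squarefree n →
        (∀ ℓ ∈ n.primeFactors, Zhang2014.IsKolyvaginPrime N W K 3 ℓ ∧
          s' ≤ Zhang2014.kolyvaginIndex W 3 ℓ) → Koly.PDiv d 3 s' := by
  subst hN
  haveI : Fact (Nat.Prime 3) := ⟨Nat.prime_three⟩
  -- `E` is non-CM (onto mod `3`), hence `BSD₃(E)` from the leaf
  have hCM : ¬ W.HasCM := fun hCM ↦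
    W.not_hasSurjectiveModNGaloisRep_of_hasCM hCM Nat.prime_three (by decide) hsurj
  have hW : BSDp W 3 := hLeaf W hCM hO6 hsurj hr
  -- a globally minimal model of the twist: a non-CM O6 row of analytic rank `0`, hence `BSD₃` from the residual
  have hD0 : (NumberField.discr K : ℚ) ≠ 0 := by exact_mod_cast NumberField.discr_ne_zero K
  haveI : (W.quadraticTwist (NumberField.discr K : ℚ)).IsElliptic := W.isElliptic_quadraticTwist hD0
  obtain ⟨Cd, hCd⟩ := hasGlobalMinimalModel_rat_holds (W.quadraticTwist (NumberField.discr K : ℚ))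
  haveI : (Cd • W.quadraticTwist (NumberField.discr K : ℚ)).IsGloballyMinimal := hCd
  set Wd := Cd • W.quadraticTwist (NumberField.discr K : ℚ) with hWd_def
  obtain ⟨hO6d, hjd⟩ := classO6_twist_of_heegner W hO6 K hK hHH hodd Wd Cd rfl
  have hCMd : ¬ Wd.HasCM := fun h ↦ hCM ((hasCM_iff_of_j_eq hjd).mp h)
  have hLd1 : Wd.entireLFunction 1 ≠ 0 := by rw [hWd_def, entireLFunction_smul]; exact hLd
  have hrd : Wd.analyticRank = 0 := analyticRank_eq_zero_of_entireLFunction_one_ne_zero Wd hLd1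
  have hWdB : BSDp Wd 3 := hZ Wd hCMd hO6d hrd
  exact sigma_at_of_bsdp_of_bsdp_towerFree hGZ hKo hGZK hmod hGZ73 hMNlow W K Dt H ι P Wd hO6 hsurj hr hK hHH hLd hP hnt hodd h3
    ⟨Cd, rfl⟩ hW hWdB

/-! ## §3 J′ (24702), J‴ (25898) BY NAME and `stub_flatMultiCarrier` VERBATIM from the leaf + the residual + print -/

/-- **J′ `WildSigmaDivisibilityAtThreeTowerFree` (stmt-BirchSwinnertonDyer-24702; all frames, no tower) BY NAME from the leaf
`WAllExclAddWildRankOneSurj`, the residual `WAllExclAddWildRankZero` and {Gross–Zagier, Kolyvagin, GZK, modularity, GZ86 I.(7.3), MN19 0.7-lower}.**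
J′ is TIGHT: no surplus over BSD₃ on the cell. CONDITIONAL; nothing asserted. [cite: GrossZagier1986, Thm. I.(6.3), (7.3) and V (2.2)]
[cite: MatarNekovar2019, Thm. 0.7 (p. 456) and §0.11 (p. 457)] [cite: Jetchev2008, Conj. 1.3 (p. 812)] -/
theorem wildSigmaDivisibilityAtThreeTowerFree_of_wAllExclAddWildRankOneSurj_of_wAllExclAddWildRankZero
    (hGZ : ∀ (N : ℕ) [NeZero N] (W : WeierstrassCurve ℚ) (K : Type) [Field K] [NumberField K],
      gross_zagier N W K)
    (hKo : ∀ (N : ℕ) [NeZero N] (W : WeierstrassCurve ℚ) (K : Type) [Field K] [NumberField K],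
      kolyvagin N W K)
    (hGZK : rank_eq_analyticRank_of_analyticRank_le_one) (hmod : hasEntireLFunction_rat)
    (hGZ73 : GrossZagier1986_thm_I_7_3)
    (hMNlow : MatarNekovar2019.thm07_pow_dvd_card_sha_primary_of_certificate_of_irreducible)
    (hLeaf : Summit.BirchSwinnertonDyer.WAllExclAddWildRankOneSurj)
    (hZ : Summit.BirchSwinnertonDyer.WAllExclAddWildRankZero) :
    WildSigmaDivisibilityAtThreeTowerFree := by
  intro W _ _ N _ K _ _ Dt H ι P hO6 hsurj hr hN hK hHH hLd hP hnt hodd h3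
  exact sigma_at_of_leaf_of_rankZero hGZ hKo hGZK hmod hGZ73 hMNlow hLeaf hZ W N K Dt H ι P hO6 hsurj hr hN hK hHH hLd hP hnt hodd h3

/-- **The crux of record J‴ `WildSigmaDivisibilityAtThreeMultiCarrier` (stmt-BirchSwinnertonDyer-25898) BY NAME from the leaf
`WAllExclAddWildRankOneSurj`, the residual `WAllExclAddWildRankZero` and the six named facts** (J′ ⟹ J‴: the multi-carrier binder is
discarded). J‴ is TIGHT: modulo print and the route's own residual Z it is a COROLLARY of the rung it serves. CONDITIONAL; nothing asserted.
[cite: GrossZagier1986, Thm. I.(6.3), (7.3) and V (2.2)] [cite: MatarNekovar2019, Thm. 0.7 (p. 456) and §0.11 (p. 457)]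
[cite: Jetchev2008, Conj. 1.3 (p. 812)] [cite: Buyukboduk2009TamagawaDefect, §4.2 Question 1] -/
theorem wildSigmaDivisibilityAtThreeMultiCarrier_of_wAllExclAddWildRankOneSurj_of_wAllExclAddWildRankZero
    (hGZ : ∀ (N : ℕ) [NeZero N] (W : WeierstrassCurve ℚ) (K : Type) [Field K] [NumberField K],
      gross_zagier N W K)
    (hKo : ∀ (N : ℕ) [NeZero N] (W : WeierstrassCurve ℚ) (K : Type) [Field K] [NumberField K],
      kolyvagin N W K)
    (hGZK : rank_eq_analyticRank_of_analyticRank_le_one) (hmod : hasEntireLFunction_rat)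
    (hGZ73 : GrossZagier1986_thm_I_7_3)
    (hMNlow : MatarNekovar2019.thm07_pow_dvd_card_sha_primary_of_certificate_of_irreducible)
    (hLeaf : Summit.BirchSwinnertonDyer.WAllExclAddWildRankOneSurj)
    (hZ : Summit.BirchSwinnertonDyer.WAllExclAddWildRankZero) :
    WildSigmaDivisibilityAtThreeMultiCarrier := by
  intro W _ _ N _ K _ _ Dt H ι P hO6 hsurj hr hN hK hHH hLd hP hnt hodd h3 _hmulti
  exact sigma_at_of_leaf_of_rankZero hGZ hKo hGZK hmod hGZ73 hMNlow hLeaf hZ W N K Dt H ι P hO6 hsurj hr hN hK hHH hLd hP hnt hodd h3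

/-- **Line `birth`'s research stub `stub_flatMultiCarrier` VERBATIM from the leaf + the residual + print** (J‴'s text with the extra binder
`¬ 3 ∣ Dt.c`, which is simply discarded): the stub carries no surplus over BSD₃ either — a counterexample to it is a counterexample to
`BSD₃(E)` or `BSD₃(E^{d_K})` or to one of the six named facts. CONDITIONAL; nothing asserted.
[cite: Buyukboduk2009TamagawaDefect, §4.2 Question 1] [cite: Jetchev2008, Conj. 1.3 (p. 812)] [cite: MatarNekovar2019, Thm. 0.7 and §0.11] -/
theorem flatMultiCarrier_of_wAllExclAddWildRankOneSurj_of_wAllExclAddWildRankZero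
    (hGZ : ∀ (N : ℕ) [NeZero N] (W : WeierstrassCurve ℚ) (K : Type) [Field K] [NumberField K],
      gross_zagier N W K)
    (hKo : ∀ (N : ℕ) [NeZero N] (W : WeierstrassCurve ℚ) (K : Type) [Field K] [NumberField K],
      kolyvagin N W K)
    (hGZK : rank_eq_analyticRank_of_analyticRank_le_one) (hmod : hasEntireLFunction_rat)
    (hGZ73 : GrossZagier1986_thm_I_7_3)
    (hMNlow : MatarNekovar2019.thm07_pow_dvd_card_sha_primary_of_certificate_of_irreducible)
    (hLeaf : Summit.BirchSwinnertonDyer.WAllExclAddWildRankOneSurj)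
    (hZ : Summit.BirchSwinnertonDyer.WAllExclAddWildRankZero) :
    ∀ (W : WeierstrassCurve ℚ) [W.IsElliptic] [W.IsGloballyMinimal] (N : ℕ) [NeZero N] (K : Type)
      [Field K] [NumberField K] (Dt : ModularParametrizationData W N)
      (H : HeegnerDatum N (NumberField.discr K)) (ι : K →+* ℂ) (P : (W.baseChange K).toAffine.Point),
      ClassO6 W 3 → W.HasSurjectiveModNGaloisRep 3 → W.analyticRank = 1 → W.conductorNorm ℤ = N →
      IsImaginaryQuadratic K → SatisfiesHeegnerHypothesis N K →
      (W.quadraticTwist (NumberField.discr K : ℚ)).entireLFunction 1 ≠ 0 →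
      WeierstrassCurve.Affine.Point.map ι.toRatAlgHom P = heegnerPointComplex Dt H →
      ¬ IsOfFinAddOrder P → Odd (NumberField.discr K) → NumberField.discr K ≠ -3 →
      ¬ (3 : ℤ) ∣ Dt.c →
      (∀ (q : ℕ) [Fact q.Prime], q ∣ N →
        padicValNat 3 ((W.baseChange ℚ_[q]).localTamagawaNumber ℤ_[q]) <
          padicValNat 3 W.tamagawaProduct + padicValNat 3 Dt.c.natAbs) →
      ∀ (s' : ℕ), s' ≤ padicValNat 3 W.tamagawaProduct + padicValNat 3 Dt.c.natAbs →
        ∀ (n : ℕ) (d : KolyvaginHeegnerData Dt H.β ι n), Squarefree n →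
          (∀ ℓ ∈ n.primeFactors, Zhang2014.IsKolyvaginPrime N W K 3 ℓ ∧
            s' ≤ Zhang2014.kolyvaginIndex W 3 ℓ) → Koly.PDiv d 3 s' := by
  intro W _ _ N _ K _ _ Dt H ι P hO6 hsurj hr hN hK hHH hLd hP hnt hodd h3 _hflat _hmulti
  exact sigma_at_of_leaf_of_rankZero hGZ hKo hGZK hmod hGZ73 hMNlow hLeaf hZ W N K Dt H ι P hO6 hsurj hr hN hK hHH hLd hP hnt hodd h3

end Summit.BirchSwinnertonDyer.BirchSwinnertonDyer.Theorems.WildSigmaDivisibilityAtThreeMultiCarrierTight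

end
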